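import Summits.ResolutionOfSingularities.ResolutionOfSingularities.Theorems.PurelyInseparableDim4ChartAtlasSNCFarChart
import HarnessLib

/-!
# Purely inseparable four-folds `z^p + F(x₁, …, x₄)`: bookkeeping for the far good SHEAR chart — partial derivatives, distinctness and
# heights of the sheared members `y_m + b_m·y_j` and of the far quadrics `y_j·y_l + d_j`, `(yᵢ + bᵢ·y_j)·y_l + dᵢ` (S3-N2; typ-2 g6)

[OURS · counted 0] (D-0157 DOOR 2; DR-157-C; desk WORD #115 (a)/(c), #131 (c)). On a shear chart `x_l` of the S3-N1 atlas
(`l ∈ S ∖ S'`, `l ≠ j`) the transformed boundary reads (p696282, and the far readings of `…ChartAtlasSNCFarGlobal`): hyperplanes,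
SHEARED near members `Sh_m = y_m + b_m·y_j`, and — for the far old members `{xᵢ = -dᵢ}`, `dᵢ ≠ 0` — the quadrics
`F_j = y_j·y_l + d_j` and `Fᵢ = (yᵢ + bᵢ·y_j)·y_l + dᵢ` (`i ∈ S ∖ {j, l}`). This file is the algebra the Jacobian engine (p701374)
consumes on that chart, PROVED (no `sorry`, no new axiom): the partial derivatives of `Sh_m`, `F_j`, `Fᵢ` (`pderiv_shear_*`,
`pderiv_farj_*`, `pderiv_far_*`), pairwise distinctness of the equation shapes (`shear_ne_X_add_C`, `shear_eq_shear_iff`,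
`farj_ne_X_add_C`, `farj_ne_shear`, `far_ne_X_add_C`, `far_ne_shear`, `far_ne_farj`, `far_eq_far_iff` — by differentiating), and
the prime-ideal facts: `X_j_mem_of_shear_mem` (a sheared member through `{y_m = 0}` forces `y_j ∈ 𝔭`), `X_not_mem_of_farj_mem`,
`not_mem_of_far_mem` (the units on a far quadric), `far_active` (an ACTIVE far quadric — through a point of `{yᵢ = 0}` — has
`bᵢ ≠ 0`, `y_j ∉ 𝔭` and height equation `bᵢ·y_j·y_l + dᵢ ∈ 𝔭`), and the two EQUAL-HEIGHT identities `height_eq_of_farj_mem`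
(`dᵢ = bᵢ·d_j`) and `height_eq_of_far_mem_of_far_mem` (`dᵢ·b_k = d_k·bᵢ`) — the resonances of p699206/p699584 seen from the chart
`x_l`. Nothing here is a statement about resolution of singularities in dimension ≥ 4 / characteristic `p` (NOT proved anywhere in
this programme). bears_on: LADDER-RESOLUTION:D157-DOOR2 (res-dim4-pi). Supports stmt-ResolutionOfSingularities-16155 (helper).
-/

-- every declaration of this summit lives under `Summit.ResolutionOfSingularities.ResolutionOfSingularities`
-- (summit = problem), which the duplicate-namespace linter flags; house convention (cf. the Target file).
set_option linter.dupNamespace false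

noncomputable section

open MvPolynomial CategoryTheory AlgebraicGeometry Opposite TopologicalSpace
open AlgebraicGeometry.Scheme.IdealSheafData (ofIdealTop)

namespace Summit.ResolutionOfSingularities.ResolutionOfSingularities.Theorems.PIDim4

open Literature.AlgebraicGeometry.Resolution
open Literature.AlgebraicGeometry.Resolution.AffinePointBlowup (P A γ coord Wtop ξ)

namespace ChartDictionary

variable {K : Type} [Field K]

/-! ## Bookkeeping for the shear chart: sheared members and far quadrics -/

section ShearBookkeeping

variable {j l : Fin 4} {b d : Fin 4 → K}

/-- `∂(y_m + b_m·y_j)/∂y_m = 1` (`m ≠ j`). -/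
theorem pderiv_shear_self {m : Fin 4} (hmj : m ≠ j) : pderiv m.succ (X m.succ + C (b m) * X j.succ : A 4 K) = 1 := by
  classical
  rw [map_add, pderiv_X_self, pderiv_C_mul, pderiv_X, Pi.single_apply,
    if_neg (fun e => hmj (Fin.succ_injective _ e).symm), mul_zero, add_zero]

/-- `∂(y_m + b_m·y_j)/∂y_j = b_m` (`m ≠ j`). -/
theorem pderiv_shear_j {m : Fin 4} (hmj : m ≠ j) : pderiv j.succ (X m.succ + C (b m) * X j.succ : A 4 K) = C (b m) := by
  classical
  rw [map_add, pderiv_X_of_ne (fun e => hmj (Fin.succ_injective _ e)), pderiv_C_mul, pderiv_X_self, mul_one, zero_add]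

/-- `∂(y_m + b_m·y_j)/∂y_k = 0` for `k ≠ m⁺, j⁺`. -/
theorem pderiv_shear_of_ne {m : Fin 4} {k : Fin (4 + 1)} (hkm : k ≠ m.succ) (hkj : k ≠ j.succ) :
    pderiv k (X m.succ + C (b m) * X j.succ : A 4 K) = 0 := by
  classical
  rw [map_add, pderiv_X_of_ne (Ne.symm hkm), pderiv_C_mul, pderiv_X_of_ne (Ne.symm hkj), mul_zero, add_zero]

/-- `∂(y_j·y_l + d)/∂y_j = y_l` (`j ≠ l`). -/
theorem pderiv_farj_j (hjl : j ≠ l) : pderiv j.succ (X j.succ * X l.succ + C (d j) : A 4 K) = X l.succ := by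
  classical
  rw [map_add, pderiv_C, add_zero, Derivation.leibniz, smul_eq_mul, smul_eq_mul, pderiv_X_self, mul_one,
    pderiv_X_of_ne (fun e => hjl (Fin.succ_injective _ e).symm), mul_zero, zero_add]

/-- `∂(y_j·y_l + d)/∂y_l = y_j` (`j ≠ l`). -/
theorem pderiv_farj_l (hjl : j ≠ l) : pderiv l.succ (X j.succ * X l.succ + C (d j) : A 4 K) = X j.succ := by
  classical
  rw [map_add, pderiv_C, add_zero, Derivation.leibniz, smul_eq_mul, smul_eq_mul, pderiv_X_self, mul_one,
    pderiv_X_of_ne (fun e => hjl (Fin.succ_injective _ e)), mul_zero, add_zero]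

/-- `∂(y_j·y_l + d)/∂y_k = 0` for `k ≠ j⁺, l⁺`. -/
theorem pderiv_farj_of_ne {k : Fin (4 + 1)} (hkj : k ≠ j.succ) (hkl : k ≠ l.succ) :
    pderiv k (X j.succ * X l.succ + C (d j) : A 4 K) = 0 := by
  classical
  rw [map_add, pderiv_C, add_zero, Derivation.leibniz, smul_eq_mul, smul_eq_mul, pderiv_X_of_ne (Ne.symm hkl),
    pderiv_X_of_ne (Ne.symm hkj), mul_zero, mul_zero, add_zero]

/-- `∂Fᵢ/∂yᵢ = y_l` for `Fᵢ = (yᵢ + bᵢ·y_j)·y_l + dᵢ` (`i ≠ j`, `i ≠ l`). -/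
theorem pderiv_far_self {i : Fin 4} (hij : i ≠ j) (hil : i ≠ l) :
    pderiv i.succ ((X i.succ + C (b i) * X j.succ) * X l.succ + C (d i) : A 4 K) = X l.succ := by
  classical
  rw [map_add, pderiv_C, add_zero, Derivation.leibniz, smul_eq_mul, smul_eq_mul, pderiv_shear_self hij,
    pderiv_X_of_ne (fun e => hil (Fin.succ_injective _ e).symm), mul_zero, zero_add, mul_one]

/-- `∂Fᵢ/∂y_j = bᵢ·y_l` (`i ≠ j`, `j ≠ l`). -/
theorem pderiv_far_j {i : Fin 4} (hij : i ≠ j) (hjl : j ≠ l) :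
    pderiv j.succ ((X i.succ + C (b i) * X j.succ) * X l.succ + C (d i) : A 4 K) = C (b i) * X l.succ := by
  classical
  rw [map_add, pderiv_C, add_zero, Derivation.leibniz, smul_eq_mul, smul_eq_mul, pderiv_shear_j hij,
    pderiv_X_of_ne (fun e => hjl (Fin.succ_injective _ e).symm), mul_zero, zero_add, mul_comm]

/-- `∂Fᵢ/∂y_l = yᵢ + bᵢ·y_j` (`i ≠ l`, `j ≠ l`). -/
theorem pderiv_far_l {i : Fin 4} (hil : i ≠ l) (hjl : j ≠ l) :
    pderiv l.succ ((X i.succ + C (b i) * X j.succ) * X l.succ + C (d i) : A 4 K) = X i.succ + C (b i) * X j.succ := by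
  classical
  rw [map_add, pderiv_C, add_zero, Derivation.leibniz, smul_eq_mul, smul_eq_mul, pderiv_X_self, mul_one,
    pderiv_shear_of_ne (fun e => hil (Fin.succ_injective _ e).symm) (fun e => hjl (Fin.succ_injective _ e).symm), mul_zero,
    add_zero]

/-- `∂Fᵢ/∂y_k = 0` for `k ≠ i⁺, j⁺, l⁺`. -/
theorem pderiv_far_of_ne {i : Fin 4} {k : Fin (4 + 1)} (hki : k ≠ i.succ) (hkj : k ≠ j.succ) (hkl : k ≠ l.succ) :
    pderiv k ((X i.succ + C (b i) * X j.succ) * X l.succ + C (d i) : A 4 K) = 0 := by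
  classical
  rw [map_add, pderiv_C, add_zero, Derivation.leibniz, smul_eq_mul, smul_eq_mul, pderiv_X_of_ne (Ne.symm hkl),
    pderiv_shear_of_ne hki hkj, mul_zero, mul_zero, add_zero]

/-- A genuinely sheared member (`b_m ≠ 0`) is not a translated hyperplane. -/
theorem shear_ne_X_add_C {m : Fin 4} (hmj : m ≠ j) (hbm : b m ≠ 0) (k : Fin (4 + 1)) (a : K) :
    (X m.succ + C (b m) * X j.succ : A 4 K) ≠ X k + C a := by
  intro h
  have h1 := congrArg (pderiv m.succ) h
  rw [pderiv_shear_self hmj, pderiv_X_add_C] at h1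
  by_cases hkm : m.succ = k
  · subst hkm
    have h2 := congrArg (pderiv j.succ) h
    rw [pderiv_shear_j hmj, pderiv_X_add_C, if_neg (fun e => hmj (Fin.succ_injective _ e).symm)] at h2
    exact hbm ((C_injective _ _) (by rw [h2, C_0]))
  · rw [if_neg hkm] at h1
    exact one_ne_zero h1

/-- Sheared members are determined by their index (`m, m' ≠ j`). -/
theorem shear_eq_shear_iff {m m' : Fin 4} (hmj : m ≠ j) (hm'j : m' ≠ j) :
    (X m.succ + C (b m) * X j.succ : A 4 K) = X m'.succ + C (b m') * X j.succ ↔ m = m' := by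
  refine ⟨fun h => ?_, fun e => by subst e; rfl⟩
  by_contra hmm
  have h1 := congrArg (pderiv m.succ) h
  rw [pderiv_shear_self hmj, pderiv_shear_of_ne (j := j) (fun e => hmm (Fin.succ_injective _ e))
    (fun e => hmj (Fin.succ_injective _ e))] at h1
  exact one_ne_zero h1

/-- `F_j = y_j·y_l + d` is not a translated hyperplane. -/
theorem farj_ne_X_add_C (hjl : j ≠ l) (k : Fin (4 + 1)) (a : K) : (X j.succ * X l.succ + C (d j) : A 4 K) ≠ X k + C a := by
  intro h
  have h1 := congrArg (fun q : A 4 K => pderiv l.succ (pderiv j.succ q)) h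
  simp only [pderiv_farj_j hjl, pderiv_X_self, pderiv_X_add_C] at h1
  by_cases hjk : j.succ = k
  · rw [if_pos hjk, Derivation.map_one_eq_zero] at h1
    exact one_ne_zero h1
  · rw [if_neg hjk, map_zero] at h1
    exact one_ne_zero h1

/-- `F_j` is not a sheared member. -/
theorem farj_ne_shear (hjl : j ≠ l) {m : Fin 4} (hml : m ≠ l) :
    (X j.succ * X l.succ + C (d j) : A 4 K) ≠ X m.succ + C (b m) * X j.succ := by
  intro h
  have h1 := congrArg (pderiv l.succ) h
  rw [pderiv_farj_l hjl, pderiv_shear_of_ne (fun e => hml (Fin.succ_injective _ e).symm)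
    (fun e => hjl (Fin.succ_injective _ e).symm)] at h1
  exact X_ne_zero _ h1

/-- `Fᵢ` is not a translated hyperplane. -/
theorem far_ne_X_add_C {i : Fin 4} (hij : i ≠ j) (hil : i ≠ l) (k : Fin (4 + 1)) (a : K) :
    ((X i.succ + C (b i) * X j.succ) * X l.succ + C (d i) : A 4 K) ≠ X k + C a := by
  intro h
  have h1 := congrArg (fun q : A 4 K => pderiv l.succ (pderiv i.succ q)) h
  simp only [pderiv_far_self hij hil, pderiv_X_self, pderiv_X_add_C] at h1
  by_cases hik : i.succ = k
  · rw [if_pos hik, Derivation.map_one_eq_zero] at h1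
    exact one_ne_zero h1
  · rw [if_neg hik, map_zero] at h1
    exact one_ne_zero h1

/-- `Fᵢ` is not a sheared member. -/
theorem far_ne_shear {i : Fin 4} (hij : i ≠ j) (hil : i ≠ l) (hjl : j ≠ l) {m : Fin 4} (hml : m ≠ l) :
    ((X i.succ + C (b i) * X j.succ) * X l.succ + C (d i) : A 4 K) ≠ X m.succ + C (b m) * X j.succ := by
  intro h
  have h1 := congrArg (fun q : A 4 K => pderiv i.succ (pderiv l.succ q)) h
  simp only [pderiv_far_l hil hjl, pderiv_shear_of_ne (fun e => hml (Fin.succ_injective _ e).symm)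
    (fun e => hjl (Fin.succ_injective _ e).symm), map_zero, pderiv_shear_self hij] at h1
  exact one_ne_zero h1

/-- `Fᵢ ≠ F_j` (`i ≠ j`). -/
theorem far_ne_farj {i : Fin 4} (hij : i ≠ j) (hil : i ≠ l) :
    ((X i.succ + C (b i) * X j.succ) * X l.succ + C (d i) : A 4 K) ≠ X j.succ * X l.succ + C (d j) := by
  intro h
  have h1 := congrArg (pderiv i.succ) h
  rw [pderiv_far_self hij hil, pderiv_farj_of_ne (fun e => hij (Fin.succ_injective _ e))
    (fun e => hil (Fin.succ_injective _ e))] at h1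
  exact X_ne_zero _ h1

/-- Far quadrics `Fᵢ` are determined by their index. -/
theorem far_eq_far_iff {i k : Fin 4} (hij : i ≠ j) (hil : i ≠ l) (hkj : k ≠ j) (hkl : k ≠ l) :
    ((X i.succ + C (b i) * X j.succ) * X l.succ + C (d i) : A 4 K) = (X k.succ + C (b k) * X j.succ) * X l.succ + C (d k) ↔
      i = k := by
  refine ⟨fun h => ?_, fun e => by subst e; rfl⟩
  by_contra hik
  have h1 := congrArg (pderiv i.succ) h
  rw [pderiv_far_self hij hil, pderiv_far_of_ne (fun e => hik (Fin.succ_injective _ e)) (fun e => hij (Fin.succ_injective _ e))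
    (fun e => hil (Fin.succ_injective _ e))] at h1
  exact X_ne_zero _ h1

/-- A sheared member through a point of `{y_m = 0}` forces `y_j ∈ 𝔭` (`b_m ≠ 0`). -/
theorem X_j_mem_of_shear_mem (x : P 4 K) {m : Fin 4} (hbm : b m ≠ 0) (hSh : (X m.succ + C (b m) * X j.succ : A 4 K) ∈ x.asIdeal)
    (hXm : (X m.succ : A 4 K) ∈ x.asIdeal) : (X j.succ : A 4 K) ∈ x.asIdeal := by
  have h := x.asIdeal.sub_mem hSh hXm
  rw [add_sub_cancel_left] at h
  have h2 := x.asIdeal.mul_mem_left (C (b m)⁻¹) h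
  rwa [← mul_assoc, ← C_mul, inv_mul_cancel₀ hbm, C_1, one_mul] at h2

/-- On `V(F_j)`: `y_j, y_l ∉ 𝔭`. -/
theorem X_not_mem_of_farj_mem (x : P 4 K) (hd : d j ≠ 0) (hF : (X j.succ * X l.succ + C (d j) : A 4 K) ∈ x.asIdeal) :
    (X j.succ : A 4 K) ∉ x.asIdeal ∧ (X l.succ : A 4 K) ∉ x.asIdeal := by
  constructor
  · intro hX
    have h := x.asIdeal.sub_mem hF (x.asIdeal.mul_mem_right (X l.succ) hX)
    rw [add_sub_cancel_left, C_mem_asIdeal_iff] at h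
    exact hd h
  · intro hX
    have h := x.asIdeal.sub_mem hF (x.asIdeal.mul_mem_left (X j.succ) hX)
    rw [add_sub_cancel_left, C_mem_asIdeal_iff] at h
    exact hd h

/-- On `V(Fᵢ)`: `y_l ∉ 𝔭` and `yᵢ + bᵢ y_j ∉ 𝔭`. -/
theorem not_mem_of_far_mem (x : P 4 K) {i : Fin 4} (hd : d i ≠ 0)
    (hF : ((X i.succ + C (b i) * X j.succ) * X l.succ + C (d i) : A 4 K) ∈ x.asIdeal) :
    (X l.succ : A 4 K) ∉ x.asIdeal ∧ (X i.succ + C (b i) * X j.succ : A 4 K) ∉ x.asIdeal := by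
  constructor
  · intro hX
    have h := x.asIdeal.sub_mem hF (x.asIdeal.mul_mem_left (X i.succ + C (b i) * X j.succ) hX)
    rw [add_sub_cancel_left, C_mem_asIdeal_iff] at h
    exact hd h
  · intro hX
    have h := x.asIdeal.sub_mem hF (x.asIdeal.mul_mem_right (X l.succ) hX)
    rw [add_sub_cancel_left, C_mem_asIdeal_iff] at h
    exact hd h

/-- **The height of an active far quadric on the shear chart.** `yᵢ ∈ 𝔭`, `Fᵢ ∈ 𝔭` ⟹ `bᵢ·y_j·y_l + dᵢ ∈ 𝔭`, `bᵢ ≠ 0`, `y_j ∉ 𝔭`. -/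
theorem far_active (x : P 4 K) {i : Fin 4} (hd : d i ≠ 0)
    (hF : ((X i.succ + C (b i) * X j.succ) * X l.succ + C (d i) : A 4 K) ∈ x.asIdeal) (hXi : (X i.succ : A 4 K) ∈ x.asIdeal) :
    (C (b i) * (X j.succ * X l.succ) + C (d i) : A 4 K) ∈ x.asIdeal ∧ b i ≠ 0 ∧ (X j.succ : A 4 K) ∉ x.asIdeal := by
  have h : (C (b i) * (X j.succ * X l.succ) + C (d i) : A 4 K) ∈ x.asIdeal := by
    have h1 := x.asIdeal.sub_mem hF (x.asIdeal.mul_mem_right (X l.succ) hXi)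
    have e : ((X i.succ + C (b i) * X j.succ) * X l.succ + C (d i) - X i.succ * X l.succ : A 4 K) =
        C (b i) * (X j.succ * X l.succ) + C (d i) := by ring
    rwa [e] at h1
  refine ⟨h, fun hb => hd ?_, fun hXj => hd ?_⟩
  · rw [hb, C_0, zero_mul, zero_add, C_mem_asIdeal_iff] at h
    exact h
  · have h2 := x.asIdeal.sub_mem h (x.asIdeal.mul_mem_left (C (b i) * X l.succ) hXj)
    have e : (C (b i) * (X j.succ * X l.succ) + C (d i) - C (b i) * X l.succ * X j.succ : A 4 K) = C (d i) := by ring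
    rw [e, C_mem_asIdeal_iff] at h2
    exact h2

/-- **Equal heights (`F_j` and an active `Fᵢ`).** -/
theorem height_eq_of_farj_mem (x : P 4 K) {i : Fin 4} (hd : d i ≠ 0)
    (hF : ((X i.succ + C (b i) * X j.succ) * X l.succ + C (d i) : A 4 K) ∈ x.asIdeal) (hXi : (X i.succ : A 4 K) ∈ x.asIdeal)
    (hFj : (X j.succ * X l.succ + C (d j) : A 4 K) ∈ x.asIdeal) : d i = b i * d j := by
  obtain ⟨h, -, -⟩ := far_active x hd hF hXi
  have h1 := x.asIdeal.sub_mem (x.asIdeal.mul_mem_left (C (b i)) hFj) h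
  have e : (C (b i) * (X j.succ * X l.succ + C (d j)) - (C (b i) * (X j.succ * X l.succ) + C (d i)) : A 4 K) =
      C (b i * d j - d i) := by
    simp only [C_sub, C_mul]; ring
  rw [e, C_mem_asIdeal_iff, sub_eq_zero] at h1
  exact h1.symm

/-- **Equal heights, twin form (two active `Fᵢ`, `F_k`).** -/
theorem height_eq_of_far_mem_of_far_mem (x : P 4 K) {i k : Fin 4} (hdi : d i ≠ 0) (hdk : d k ≠ 0)
    (hFi : ((X i.succ + C (b i) * X j.succ) * X l.succ + C (d i) : A 4 K) ∈ x.asIdeal) (hXi : (X i.succ : A 4 K) ∈ x.asIdeal)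
    (hFk : ((X k.succ + C (b k) * X j.succ) * X l.succ + C (d k) : A 4 K) ∈ x.asIdeal) (hXk : (X k.succ : A 4 K) ∈ x.asIdeal) :
    d i * b k = d k * b i := by
  obtain ⟨hi, -, -⟩ := far_active x hdi hFi hXi
  obtain ⟨hk, -, -⟩ := far_active x hdk hFk hXk
  have h1 := x.asIdeal.sub_mem (x.asIdeal.mul_mem_left (C (b k)) hi) (x.asIdeal.mul_mem_left (C (b i)) hk)
  have e : (C (b k) * (C (b i) * (X j.succ * X l.succ) + C (d i)) - C (b i) * (C (b k) * (X j.succ * X l.succ) + C (d k)) :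
      A 4 K) = C (d i * b k - d k * b i) := by
    simp only [C_sub, C_mul]; ring
  rw [e, C_mem_asIdeal_iff, sub_eq_zero] at h1
  exact h1

end ShearBookkeeping

end ChartDictionary

end Summit.ResolutionOfSingularities.ResolutionOfSingularities.Theorems.PIDim4

end
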